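import Literature.Claims.NS.Svancara2025
import Literature.Analysis.FluidPDE.NSVorticityBKMHolds
import Literature.Analysis.FluidPDE.TaoEnstrophyLocalisation
import HarnessLib

/-!
# Solo salvage for claim C96 `Svancara2025` (cell `ns-claims`, D-0090): Step 2 (p.4 l.9–13, «a maximal
# time of smoothness t* < ∞ ⇒ lim sup ‖∇v(t)‖_{L∞} = ∞») holds in the Beale–Kato–Majda class, kernel

Claim skeleton: `Literature/Claims/NS/Svancara2025.lean` (C. Svancara, OSF egxnq, 4 pp.; typist
`ns-claims-typist-6` g5, p517921). The skeleton's `Step2_BlowupCriterion` is typed for EVERY classical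
solution of the unforced system on `[0, t*) × ℝ³` from a smooth divergence-free finite-energy datum with no
classical extension past `t*`; at that grain it is over-wide (referee ref-4 g5, README ROUTE 5b / F3: the
pressure-driven parasitic family `v = g(t)e₁`, `p = −g′(t)x₁`, `g(0) = 0`, `g → ∞` at `t*` has `∇v ≡ 0`;
never a locator). This file (seat `ns-claims-salvage-p3` g4) certifies the step at the print's class read in
the Beale–Kato–Majda sense («smooth solution» = classical with all `L²` Sobolev norms bounded on every
compact sub-slab, tree `HasBoundedSobolevNormsOn`): if such a solution admits no classical extension past
`t*`, then `‖∇v‖` is unbounded on `[0, t*) × ℝ³`. Proof: no classical extension ⇒ no extension in the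
class (`HasSobolevExtensionPast.hasSmoothExtensionPast`), hence `∫₀^{t*} ‖curl v(t)‖_∞ dt = ∞` by
Beale–Kato–Majda (tree `lintegral_iSup_curl_eq_top_of_not_hasSobolevExtensionPast_holds`, PROVED), while a
uniform bound `‖∇v‖ ≤ M` would give `‖curl v‖_∞ ≤ ‖curlCLM‖ M` (`norm_curl_le`) and a finite integral.

* `step2_bkmClass_holds` — `Step2_BlowupCriterion` with the extra class hypothesis
  `∀ T'' < t*, HasBoundedSobolevNormsOn (Icc 0 T'') v` (everything else verbatim, same binder order);
* `step2BKM_holds : Step2_BlowupCriterionBKM` — the skeleton's rev-3 face of the same statement (p519662).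

Solo lane (`Theorems/SoloSalvage<Slug>….lean`, no item); records-grade, no token effect.

WHAT THIS IS NOT: not a claim about NS regularity or blow-up; not a claim about any author beyond the
typed locator.
-/

noncomputable section

set_option linter.dupNamespace false

open Set MeasureTheory
open scoped ENNReal

namespace Summit.NavierStokesRegularity.NavierStokesRegularity.Theorems.Svancara2025Salvage

open Literature.Analysis Literature.Analysis.FluidPDE Literature.Claims.NS.Svancara2025

/-- **Step 2 in the Beale–Kato–Majda class** (p.4 l.9–13 «Assume, for contradiction, a maximal time of
smoothness t* < ∞. Then lim sup_{t→t*⁻} ‖∇v(t)‖_{L∞} = ∞»): for `ν > 0`, a datum of the theorem's class, and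
a classical solution `(v, p)` of the unforced system on `[0, t*) × ℝ³` from it whose `L²` Sobolev norms of
all orders are bounded on every `[0, T'']`, `T'' < t*`, if `(v, p)` has no classical extension past `t*`
then `‖∇v(t, x)‖` is unbounded on `[0, t*) × ℝ³`. (Beale–Kato–Majda 1984 Thm 1: the time integral of
`‖curl v‖_∞` diverges; a bounded velocity gradient would bound it.)
[cite: Svancara2025, §2 p.4 l.9–13] [cite: BealeKatoMajda1984, Theorem 1 and Corollary] -/
theorem step2_bkmClass_holds :
    ∀ ν : ℝ, 0 < ν → ∀ (v₀ : E3 → E3) (v : ℝ → E3 → E3) (p : ℝ → E3 → ℝ) (tstar : ℝ), 0 < tstar →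
      IsDatum v₀ → IsClassicalNSSolutionOn (Ico 0 tstar) ν 0 v p → v 0 = v₀ →
      (∀ T'' < tstar, HasBoundedSobolevNormsOn (Icc 0 T'') v) →
      ¬ HasSmoothExtensionPast ν 0 v tstar →
        ∀ M : ℝ, ∃ t ∈ Ico 0 tstar, ∃ x : E3, M < ‖fderiv ℝ (v t) x‖ := by
  intro ν hν v₀ v p tstar htstar _hd hsol _hv0 hreg hmax M
  by_contra hcon
  have hbound : ∀ t ∈ Ico 0 tstar, ∀ x : E3, ‖fderiv ℝ (v t) x‖ ≤ M := by
    intro t ht x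
    by_contra hlt
    exact hcon ⟨t, ht, x, lt_of_not_ge hlt⟩
  -- no classical extension ⇒ no extension in the BKM class ⇒ the BKM integral diverges
  have hmax' : ¬ HasSobolevExtensionPast ν v tstar := fun h => hmax h.hasSmoothExtensionPast
  have htop := lintegral_iSup_curl_eq_top_of_not_hasSobolevExtensionPast_holds hν.le htstar hsol hreg hmax'
  -- but a uniform gradient bound makes it finite
  set κ : ℝ := ‖(curlCLM : (E3 →L[ℝ] E3) →L[ℝ] E3)‖ with hκ
  have hκ0 : 0 ≤ κ := ContinuousLinearMap.opNorm_nonneg _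
  have hsup : ∀ t ∈ Ioo 0 tstar, (⨆ x, ‖curl (v t) x‖ₑ) ≤ ENNReal.ofReal (κ * M) := by
    intro t ht
    refine iSup_le fun x => ?_
    rw [← ofReal_norm]
    exact ENNReal.ofReal_le_ofReal
      ((norm_curl_le (v t) x).trans (mul_le_mul_of_nonneg_left (hbound t ⟨ht.1.le, ht.2⟩ x) hκ0))
  have hfin : (∫⁻ t in Ioo 0 tstar, ⨆ x, ‖curl (v t) x‖ₑ) ≤
      ENNReal.ofReal (κ * M) * volume (Ioo (0 : ℝ) tstar) := by
    calc (∫⁻ t in Ioo 0 tstar, ⨆ x, ‖curl (v t) x‖ₑ)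
        ≤ ∫⁻ _ in Ioo 0 tstar, ENNReal.ofReal (κ * M) :=
          setLIntegral_mono measurable_const fun t ht => hsup t ht
      _ = ENNReal.ofReal (κ * M) * volume (Ioo (0 : ℝ) tstar) := setLIntegral_const _ _
  have hlt : (∫⁻ t in Ioo 0 tstar, ⨆ x, ‖curl (v t) x‖ₑ) < ⊤ := by
    refine lt_of_le_of_lt hfin ?_
    rw [Real.volume_Ioo]
    exact ENNReal.mul_lt_top ENNReal.ofReal_lt_top ENNReal.ofReal_lt_top
  exact absurd htop hlt.ne

/-- **The skeleton's BKM-class face of Step 2 holds**: `Literature.Claims.NS.Svancara2025.Step2_BlowupCriterionBKM`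
(rev 3 p519662, typist-6 g5 — the same statement as `step2_bkmClass_holds`, typed in the claim file).
[cite: Svancara2025, §2 p.4 l.9–13] [cite: BealeKatoMajda1984, Theorem 1 and Corollary] -/
theorem step2BKM_holds : Step2_BlowupCriterionBKM :=
  step2_bkmClass_holds

end Summit.NavierStokesRegularity.NavierStokesRegularity.Theorems.Svancara2025Salvage

end
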